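import Summits.BirchSwinnertonDyer.Rank1Residual.X12.CMRamifiedRecordSchemaGIndex
import HarnessLib

/-!
# Leaf `CornerF ∧ CMRamified`, slice `p = 3`: PART G addendum — the display tally `vTally` / `vCheck`
# of a list of regime-V records, and the `tV = 0` reading (`sV = 2`)

HONEST FRAMING (cell `bsd-print-cfram`, run/shared/lean/pub/bsd-print-cfram/, verbatim in every file
of the cell): PARTITION currency only — the leaf counts when its class theorem is in the kernel BY
NAME, flag-free; Literature named facts are statement-only with cite tags, never sorried theorems;
every imported theorem carries its printed hypotheses verbatim; numbers, not adjectives. THIS FILE IS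
DATA INFRASTRUCTURE (two computable functions on lists of `VRow`s + unpacking lemmas); nothing about
any elliptic curve is asserted, no named fact is introduced, nothing is booked, no mark moves (the leaf
K12r, its `p = 3` slice `Summit.BirchSwinnertonDyer.WAllCornerFRamifiedAtThree` and the regime child V
`SplitPlaceTorsionBSDThree` = stmt-BirchSwinnertonDyer-20700 of route `PrintCFram` stay OPEN).

WHY (lit g6 NOTICE, STATUS 2026-08-27T19:02:44Z, census kit j284848 + verification j287536): among the
216 regime-V frames `N ≤ 2·10⁸` of lit's census, **`t = 0` occurs (27/216, all with `N ≥ 3 594 816`)** —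
both members' generators ON the identity component at the V-prime — so the bottom-index exponent
`s = #S_V − t` of the V value law takes BOTH values `1` and `2`; the sentences «`tV = 1`, `sV = 1` on
every known frame» in `X12/CMRamifiedRecordSchemaGIndex.lean` / `X12/CMRamifiedVRegimeThree{,Beyond}.lean`
are statements about the 49 frames `N ≤ 3·10⁶` recorded there (20 + 29), true as displayed, and do NOT
extend. The display files `X12/CMRamifiedVRegimeThreeFar{A,B,C,D}.lean` (PART G-C) record the census
frames not already in PART G / G-B; each states ONE theorem `vCheck rows (n, n₀, n₁, n₂) = true`:
all records consistent (schema G's `VRow.consistent`, unchanged) and the tally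
`vTally rows = (#rows, #{tV = 0}, #{tV = 1}, #{nSV = 2})`. On a consistent record with one V-prime
(`nSV = 2`): `tV = 0 → sV = 2` (`VRow.sV_eq_two_of`, below) and `tV = 1 → sV = 1` (`VRow.sV_eq_one_of`,
GIndex). `3^{tV} = #coker(loc_{S_V})`, `3^{sV}` = ty2's displayed `controlDefectAtThree … T₀` remain the
lit §32/§35 identifications — displayed, never bound (REF R0.12 (iv), R0.15).
-/

set_option autoImplicit false

namespace Summit.BirchSwinnertonDyer.Rank1Residual.X12.CMRamifiedRecords

/-! ### §1 The tally and the display check -/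

/-- Tally of a list of regime-V records: `(#rows, #{tV = 0}, #{tV = 1}, #{nSV = 2})`. [folklore] -/
def vTally (rs : List VRow) : ℕ × ℕ × ℕ × ℕ :=
  (rs.length, (rs.filter fun r => r.tV == 0).length, (rs.filter fun r => r.tV == 1).length,
    (rs.filter fun r => r.nSV == 2).length)

/-- Display check: all records consistent (`VRow.consistent`) and the tally as stated. [folklore] -/
def vCheck (rs : List VRow) (t : ℕ × ℕ × ℕ × ℕ) : Bool :=
  rs.all VRow.consistent && (vTally rs == t)

/-- Unpacking `vCheck`. [folklore] -/
theorem vCheck_iff (rs : List VRow) (t : ℕ × ℕ × ℕ × ℕ) :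
    vCheck rs t = true ↔ rs.all VRow.consistent = true ∧ vTally rs = t := by
  simp only [vCheck, Bool.and_eq_true, beq_iff_eq]

/-- Unpacking a display theorem per member: every listed record is consistent. [folklore] -/
theorem VRow.consistent_of_vCheck {rs : List VRow} {t : ℕ × ℕ × ℕ × ℕ} (h : vCheck rs t = true)
    {r : VRow} (hr : r ∈ rs) : r.consistent = true :=
  List.all_eq_true.1 ((vCheck_iff rs t).1 h).1 r hr

/-- The tally of a checked display. [folklore] -/
theorem vTally_eq_of_vCheck {rs : List VRow} {t : ℕ × ℕ × ℕ × ℕ} (h : vCheck rs t = true) :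
    vTally rs = t :=
  ((vCheck_iff rs t).1 h).2

/-- If the tally of a checked display has `#{nSV = 2} = #rows`, every listed record has exactly one
V-prime (`nSV = 2`). [folklore] -/
theorem VRow.nSV_eq_two_of_vCheck {rs : List VRow} {n n₀ n₁ : ℕ} (h : vCheck rs (n, n₀, n₁, n) = true)
    {r : VRow} (hr : r ∈ rs) : r.nSV = 2 := by
  have ht := vTally_eq_of_vCheck h
  simp only [vTally, Prod.mk.injEq] at ht
  obtain ⟨hlen, -, -, hn⟩ := ht
  rw [← hlen] at hn
  simpa using List.length_filter_eq_length_iff.1 hn r hr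

/-! ### §2 Reading `tV = 0` -/

namespace VRow

/-- Reading a display row with `tV = 0` and `nSV = 2` (one split V-prime, BOTH members' generators ON the
identity component): `sV = 2` — the full Tamagawa exponent `#S_V`. First instances: lit census j284848
(27/216 frames, `N ≥ 3 594 816`), recorded in `X12/CMRamifiedVRegimeThreeFar*.lean`. [folklore] -/
theorem sV_eq_two_of {r : VRow} (h : r.consistent = true) (ht : r.tV = 0) (hn : r.nSV = 2) :
    r.sV = 2 := by
  have := tV_add_sV_of_consistent h
  omega

/-- On a consistent record with one V-prime, `sV = 2 − tV` and `tV ≤ 2`, so `sV ∈ {0, 1, 2}` with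
`sV = 2 ↔ tV = 0` and `sV = 1 ↔ tV = 1`. [folklore] -/
theorem sV_eq_two_sub_tV_of {r : VRow} (h : r.consistent = true) (hn : r.nSV = 2) :
    r.sV = 2 - r.tV ∧ r.tV ≤ 2 ∧ (r.sV = 2 ↔ r.tV = 0) ∧ (r.sV = 1 ↔ r.tV = 1) := by
  have h1 := tV_add_sV_of_consistent h
  obtain ⟨-, -, h2, -⟩ := sV_spec_of_consistent h
  omega

/-- `tV = 0` on a consistent record means both component bits are `false`, i.e. both generators are ON the
identity component at the V-prime: `bitW = false ∧ bitW' = false`. [folklore] -/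
theorem bits_eq_false_of_tV_eq_zero {r : VRow} (h : r.consistent = true) (ht : r.tV = 0) :
    r.bitW = false ∧ r.bitW' = false := by
  obtain ⟨h1, -, -, -⟩ := tV_spec_of_consistent h
  rw [ht] at h1
  cases hb : r.bitW <;> cases hb' : r.bitW' <;> simp [hb, hb'] at h1 ⊢

end VRow

end Summit.BirchSwinnertonDyer.Rank1Residual.X12.CMRamifiedRecords
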